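import Summits.ResolutionOfSingularities.ResolutionOfSingularities.Theorems.HomologicalConductorNoZenoCap3RungCapture
import HarnessLib

/-!
# Crux `NoZenoR` (stmt-ResolutionOfSingularities-19943), slot 2, tr.deg-3 half `Cap3` / `BoundedRung3`:
# THE CAPTURE INDEX IS MONOTONE; MONOTONE GENERIC-FIBRE STAGES

OURS (cell res-hironaka, crux chain W4.4; lead res-L0-w44-lead-1 g10, OBJECT 2-X = CRUX-PLAN v7 §2 (2-ii) «monotone choice of generic-fibre
stages» + DESK WORD 41 (U4), both immediate from the ladder of 2-U `…NoZenoCap3RungCapture`).  AI-written, weaker than expert review;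
nothing here is a statement of the manuscript under review (Hironaka 2017).  SUPPORT-level, counted 0.  Def-free, fact-free.

* `exists_monotone_captureIndex` — along any two-dimensional regular ladder `R_•` along `O` (as in `NoetherianCapture.stage_captured_by_rung`)
  the stages are captured by a MONOTONE rung index `i : ℕ → ℕ`, `T_m ⊆ R (i m)` (running maximum of the capture indices).
* `boundedRung_iff_forall` — «one rung holds all LATE stages» ⟺ «one rung holds ALL stages» (the tower is increasing).
* `exists_monotone_genericFibreStages` — at Cap3's binders (kernel binder, `IH`, `tr.deg_k K = 3`, branch (b)): an INCREASING sequence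
  `D 0 ≤ D 1 ≤ ⋯` of regular local `k`-subalgebras of `O`, dominated by `O`, containing `k⟮t⟯` for the unreachable `t`, with `T_m ≤ D m` —
  the rungs `R (i m)` of the generic-fibre ladder (CRUX-PLAN v7 §2 (2-ii) asked for this as the first Cap3 lemma; by 2-U it is free).
  BoundedRung3 ⟺ the sequence `D` can be taken CONSTANT.

References: S. Abhyankar, Amer. J. Math. 78 (1956), Lemma 12 and Prop. 8 [`Abhyankar1956Valuations`] (tree `AbhyankarQuadraticUnion_holds`,
`isRegularLocalRing_sequence`).
-/

noncomputable section

-- single-problem summit: the doubled namespace component `ResolutionOfSingularities` is forced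
set_option linter.dupNamespace false

namespace Summit.ResolutionOfSingularities.ResolutionOfSingularities.Theorems.NoZeno.Beta1Trdeg3

open Summit.ResolutionOfSingularities.ResolutionOfSingularities.Theses.HomologicalConductor
open Summit.ResolutionOfSingularities.ResolutionOfSingularities.Theorems.NoZeno.Birth
open Summit.ResolutionOfSingularities.ResolutionOfSingularities.Theorems
open Summit.ResolutionOfSingularities.ResolutionOfSingularities.Theorems.NoZeno
open Summit.ResolutionOfSingularities.ResolutionOfSingularities.Theorems.NoZeno.NoetherianCapture
open Literature.AlgebraicGeometry.Resolution
open IsLocalRing Polynomial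
open scoped IntermediateField

variable {k K : Type} [Field k] [Field K] [Algebra k K]

/-! ## The capture index can be taken monotone -/

/-- **MONOTONE CAPTURE INDEX.**  Along a two-dimensional regular ladder `R 0 → R 1 → ⋯` along `O` containing `k`, the stages of the canonical
`ca`-tower are captured by a MONOTONE rung index: `T_m ⊆ R (i m)` with `i` non-decreasing (the running maximum of the indices of
`stage_captured_by_rung`; rungs increase). [this work; cite: Abhyankar1956Valuations, Lemma 12] -/
theorem exists_monotone_captureIndex (p : ℕ) (hp : p.Prime) (k K : Type)
    [Field k] [CharP k p] [Field K] [Algebra k K] (O : ValuationSubring K) (A : Subalgebra k K)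
    (hk : ∀ c : k, algebraMap k K c ∈ O) (hA : A.FG) (hfr : IsFractionRing ↥A K)
    (hAO : A.toSubring ≤ O.toSubring) (R : ℕ → Subring K) (hreg : IsRegularLocalRing ↥(R 0))
    (hdim : ringKrullDim ↥(R 0) = 2) (hof : IsLocalRingOf (R 0)) (hdomR : SubringDominates (R 0) O.toSubring)
    (hstep : ∀ i, IsQuadraticTransformAlong O (R i) (R (i + 1))) (hkR : ∀ c : k, algebraMap k K c ∈ R 0) :
    ∃ i : ℕ → ℕ, Monotone i ∧ ∀ m : ℕ, ∀ x ∈ tower O A m, x ∈ R (i m) := by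
  classical
  choose i₀ hi₀ using stage_captured_by_rung p hp k K O A hk hA hfr hAO R hreg hdim hof hdomR hstep hkR
  have hmono : Monotone R := sequence_monotone hstep
  refine ⟨fun m => (Finset.range (m + 1)).sup i₀, fun m n hmn => ?_, fun m x hx => ?_⟩
  · exact Finset.sup_mono (Finset.range_mono (Nat.succ_le_succ hmn))
  · exact hmono (Finset.le_sup (f := i₀) (Finset.self_mem_range_succ m)) (hi₀ m x hx)

/-- **Late capture is capture**: one rung holds all late stages iff one rung holds all stages (the tower increases, `d2rc_mem_tower_of_le`).
[this work] -/
theorem boundedRung_iff_forall (O : ValuationSubring K) (A : Subalgebra k K) (R : ℕ → Subring K) :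
    (∃ i m₀ : ℕ, ∀ m : ℕ, m₀ ≤ m → ∀ x ∈ tower O A m, x ∈ R i) ↔ ∃ i : ℕ, ∀ m : ℕ, ∀ x ∈ tower O A m, x ∈ R i := by
  constructor
  · rintro ⟨i, m₀, h⟩
    refine ⟨i, fun m x hx => ?_⟩
    rcases le_or_gt m₀ m with hm | hm
    · exact h m hm x hx
    · exact h m₀ le_rfl x (d2rc_mem_tower_of_le O A hm.le hx)
  · rintro ⟨i, h⟩
    exact ⟨i, 0, fun m _ x hx => h m x hx⟩

/-- A rung of a ladder containing `k`, as a `k`-subalgebra of `K`. [bookkeeping] -/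
theorem exists_subalgebra_eq_rung {O : ValuationSubring K} (R : ℕ → Subring K)
    (hstep : ∀ i, IsQuadraticTransformAlong O (R i) (R (i + 1)))
    (hkR : ∀ c : k, algebraMap k K c ∈ R 0) (i : ℕ) : ∃ D : Subalgebra k K, D.toSubring = R i :=
  ⟨{ carrier := R i
     mul_mem' := fun ha hb => (R i).mul_mem ha hb
     one_mem' := (R i).one_mem
     add_mem' := fun ha hb => (R i).add_mem ha hb
     zero_mem' := (R i).zero_mem
     algebraMap_mem' := fun c => sequence_monotone hstep (Nat.zero_le i) (hkR c) }, rfl⟩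

/-! ## Monotone generic-fibre stages at Cap3's binders -/

/-- **MONOTONE GENERIC-FIBRE STAGES (CRUX-PLAN v7 §2 (2-ii); fact-free).**  At the binders of `Cap3` — kernel binder, induction hypothesis,
`tr.deg_k K = 3`, branch (b) — there is an INCREASING sequence `D 0 ≤ D 1 ≤ ⋯` of REGULAR local `k`-subalgebras of `O`, each dominated by
`O` and containing `k⟮t⟯` for the unreachable residually transcendental `t`, with `T_m ≤ D m` for every `m`: the rungs `R (i m)` of the
generic-fibre ladder (`exists_ladder_of_cap3Binders`) at a monotone capture index (`exists_monotone_captureIndex`); rungs are regular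
(tree `isRegularLocalRing_sequence`) and dominated by `O` (`sequence_dominates`).  `Cap3` ⟺ `D` can be taken constant (`boundedRung3_of_cap3`,
`boundedRung_iff_forall`). [this work; cite: Abhyankar1956Valuations, Lemma 12 and Prop. 8] -/
theorem exists_monotone_genericFibreStages (p : ℕ) (hp : p.Prime) (k K : Type) [Field k] [CharP k p]
    [Field K] [Algebra k K] (O : ValuationSubring K) (A : Subalgebra k K)
    (hk : ∀ c : k, algebraMap k K c ∈ O) (hA : A.FG) (hfr : IsFractionRing ↥A K)
    (hAO : A.toSubring ≤ O.toSubring)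
    (hker : ∀ O' : ValuationSubring K,
      (∀ m : ℕ, ∀ s ∈ tower O A m, s ∈ O' ∧ (s⁻¹ ∈ O' → s⁻¹ ∈ O)) → ¬ IsNoetherianRing ↥O')
    (IH : ∀ (k' K' : Type) [Field k'] [CharP k' p] [Field K'] [Algebra k' K'] (O' : ValuationSubring K')
      (A' : Subalgebra k' K'), (∀ c : k', algebraMap k' K' c ∈ O') → A'.FG → IsFractionRing ↥A' K' →
      A'.toSubring ≤ O'.toSubring → Algebra.trdeg k' K' < Algebra.trdeg k K →
      ∃ m : ℕ, IsRegularLocalRing ↥(tower O' A' m))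
    (htr : Algebra.trdeg k K = 3)
    (hb : ∃ t : K, t ∈ O ∧ (∀ m : ℕ, t ∉ tower O A m) ∧
      ∀ f : Polynomial k, f ≠ 0 → ¬ O.valuation (Polynomial.aeval t f) < 1) :
    ∃ D : ℕ → Subalgebra k K, Monotone D ∧ (∀ m : ℕ, IsRegularLocalRing ↥(D m) ∧ tower O A m ≤ D m ∧
      (D m).toSubring ≤ O.toSubring ∧ (∀ x ∈ D m, x⁻¹ ∈ O → x⁻¹ ∈ D m)) ∧
      ∃ t : K, (∀ n : ℕ, t ∉ tower O A n) ∧ ∀ m : ℕ, ∀ x : K, x ∈ k⟮t⟯ → x ∈ D m := by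
  classical
  obtain ⟨R, hreg, hdim, hof, hdomR, hstep, hkR, -, t, htT, htR⟩ :=
    exists_ladder_of_cap3Binders p hp k K O A hk hA hfr hAO hker IH htr hb 0
  obtain ⟨i, himono, hi⟩ := exists_monotone_captureIndex p hp k K O A hk hA hfr hAO R hreg hdim hof hdomR hstep hkR
  choose D hD using exists_subalgebra_eq_rung (O := O) R hstep hkR
  have hmem : ∀ j (x : K), x ∈ D j ↔ x ∈ R j := fun j x => by
    rw [← Subalgebra.mem_toSubring, hD]
  have hmonoR : Monotone R := sequence_monotone hstep
  refine ⟨fun m => D (i m), fun m n hmn x hx => ?_, fun m => ⟨?_, ?_, ?_, ?_⟩, t, htT, fun m x hx => ?_⟩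
  · exact (hmem _ x).mpr (hmonoR (himono hmn) ((hmem _ x).mp hx))
  · haveI : IsRegularLocalRing ↥(R (i m)) := isRegularLocalRing_sequence hreg hstep (i m)
    have e : (D (i m)).toSubring = R (i m) := hD (i m)
    exact IsRegularLocalRing.of_ringEquiv (R := ↥(R (i m)))
      (RingEquiv.subringCongr e.symm : ↥(R (i m)) ≃+* ↥(D (i m)).toSubring)
  · exact fun x hx => (hmem _ x).mpr (hi m x hx)
  · rw [hD]; exact (sequence_dominates hdomR hstep (i m)).1.1
  · intro x hx hxO
    exact (hmem _ _).mpr ((sequence_dominates hdomR hstep (i m)).1.2 x ((hmem _ x).mp hx) hxO)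
  · exact (hmem _ x).mpr (hmonoR (Nat.zero_le _) (htR x hx))

end Summit.ResolutionOfSingularities.ResolutionOfSingularities.Theorems.NoZeno.Beta1Trdeg3

end
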